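import Summits.BirchSwinnertonDyer.Rank1Residual.Additive.PowerMapSubstitution
import HarnessLib

/-!
# Rigidity of the `p`-power functional equation `α·B·B'((1+T)^p-1) = α'·B'·B((1+T)^p-1)` in
# `Λ = ℤ_p⟦T⟧` and in `Λ ⊗ ℚ_p` (cell `b2b-bsdres`, sub-cell additive-p2, gen 21)

HONEST FRAMING (cell `b2b-bsdres`, run/shared/lean/b2b/bsd-rank1-residual/, verbatim in every
file): the goal of the cell is to DELETE the COMBINATION-SHAPED residual classes of the
Birch–Swinnerton-Dyer formula for ALL analytic-rank `≤ 1` elliptic curves over `ℚ` — "full BSD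
formula for every rank `≤ 1` curve in class `C`" assembled STRICTLY from published theorems — so
that the rank-`≤ 1` remainder becomes exactly the CONSTRUCTION-SHAPED classes, which are TYPED
(missing-input `Prop`s), NOT attempted. This is not "finishing BSD". Research route on the
CONSTRUCTION-SHAPED classes X3♯(G-ord)/X4♯(G-ord) (sub-cell additive-p2, gen 21); THEOREMS ONLY —
no definition, no named fact, no conjecture node; labels / RESIDUAL-MAP marks UNCHANGED; nothing
booked.

Companion of `PowerMapSubstitution.lean` (the substitution `G ↦ G((1+T)^p - 1)`). THE RESULT
(`eq_and_exists_eq_C_mul_of_mul_subst_eq`): if `B, B' ∈ ℚ_p⟦T⟧` are non-zero with bounded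
coefficients (`MemIwasawaRat`), `α ≠ 0`, and `α·B·B'((1+T)^p-1) = α'·B'·B((1+T)^p-1)`, then
`α = α'` and `B' = d·B` for a CONSTANT `d ∈ ℚ_p` — the algebraic heart of the TUPLE RIGIDITY of
interpolation packages of cyclotomic `p`-adic `L`-functions (`TameBranchRigidity.lean`: two bounded
interpolants of the same twisted `L`-values with Euler-type constants `a^{-m}`, `a'^{-m}` satisfy
this functional equation — pair a character of conductor `p^{m+1}` with its `p`-th power).
Proof (§1, integral form, `G, G' ∈ Λ` with non-zero reduction, `u` a unit): Weierstrass-factor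
`G = P·U`, `G' = P'·U'` (Mathlib `exists_isWeierstrassFactorization`); the power map carries
Weierstrass factorizations to Weierstrass factorizations, so by UNIQUENESS
(`IsWeierstrassFactorization.elim`) `P'·P((1+X)^p-1) = P·P'((1+X)^p-1)`, whence `P = P'`
(`eq_of_mul_comp_eq_mul_comp` in `ℚ_p[X]`), and `V = U'/U` satisfies `V = u·V((1+T)^p-1)`, so
`u = 1` and `V` is constant (`eq_C_of_eq_C_mul_subst_one_add_X_pow_sub_one`). §2 (rational form)
clears denominators and `p`-contents (`IwasawaAlgebra.exists_eq_C_pow_mul_and_map_residue_ne_zero`);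
the valuations of the two constants agree by reduction mod `p` (`eq_of_C_mul_pow_mul_eq`). Also
`Λ ⊗ ℚ_p` is closed under products, scalars and the power map. No definitions, no named facts.

## References

* L. C. Washington, *Introduction to cyclotomic fields*, GTM 83, Thm. 7.3, §13.2. [Washington1997]
* B. Mazur, J. Tate, J. Teitelbaum, Invent. Math. 84 (1986), §I.12 (`Λ ⊗ ℚ`). [MazurTateTeitelbaum1986Invent]
-/

noncomputable section

namespace Summit.BirchSwinnertonDyer.Rank1Residual.Additive

open Literature.NumberTheory.EllipticCurves

/-! ### §1 Rigidity of the functional equation `G'·(G∘φ) = u·G·(G'∘φ)` on `Λ` -/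

section IntegralRigidity

open _root_.PowerSeries

variable {p : ℕ} [hp : Fact p.Prime]

/-- The Weierstrass factorization of `G` transported along the `p`-power map: if `G = P · U` with
`P` distinguished and `U` a unit, then `G((1+T)^p - 1) = P((1+X)^p - 1) · U((1+T)^p - 1)` is again
a (distinguished polynomial) × (unit) factorization. [folklore] -/
theorem isWeierstrassFactorization_subst_one_add_X_pow_prime_sub_one {G : PowerSeries ℤ_[p]}
    {P : Polynomial ℤ_[p]} {U : PowerSeries ℤ_[p]} (H : G.IsWeierstrassFactorization P U) :
    PowerSeries.IsWeierstrassFactorization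
      (G.subst ((1 + X : PowerSeries ℤ_[p]) ^ p - 1) : PowerSeries ℤ_[p])
      (P.comp ((1 + Polynomial.X : Polynomial ℤ_[p]) ^ p - 1))
      (U.subst ((1 + X : PowerSeries ℤ_[p]) ^ p - 1)) := by
  obtain ⟨hdist, hdeg⟩ := isDistinguishedAt_one_add_X_pow_prime_sub_one (p := p)
  refine ⟨isDistinguishedAt_comp H.isDistinguishedAt hdist (by rw [hdeg]; exact hp.out.ne_zero),
    isUnit_subst_one_add_X_pow_sub_one p H.isUnit, ?_⟩
  rw [H.eq_mul, subst_mul (hasSubst_one_add_X_pow_sub_one p), subst_coe_eq_coe_comp]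

/-- **Rigidity of the `p`-power functional equation on `Λ = ℤ_p⟦T⟧.** Let `G, G' ∈ Λ` have
non-zero reduction mod `p`, `u ∈ ℤ_p^×`, and suppose
`G' · G((1+T)^p - 1) = u · G · G'((1+T)^p - 1)`. Then `u = 1` and `G' = d · G` for a unit
`d ∈ ℤ_p^×`. Proof: Weierstrass-factor `G = P U`, `G' = P' U'`; by uniqueness of the Weierstrass
factorization of the common value, `P' · P((1+X)^p-1) = P · P'((1+X)^p-1)`, whence `P = P'` by the
polynomial rigidity `eq_of_mul_comp_eq_mul_comp` (in `ℚ_p[X]`); then `V = U'/U` satisfies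
`V = u · V((1+T)^p-1)`, so `u = 1` and `V` is constant (`eq_C_of_eq_C_mul_subst_one_add_X_pow_sub_one`).
[folklore] -/
theorem eq_one_and_exists_eq_C_mul_of_mul_subst_eq {G G' : PowerSeries ℤ_[p]}
    (hG : PowerSeries.map (IsLocalRing.residue ℤ_[p]) G ≠ 0)
    (hG' : PowerSeries.map (IsLocalRing.residue ℤ_[p]) G' ≠ 0) {u : ℤ_[p]} (hu : IsUnit u)
    (h : G' * G.subst ((1 + X : PowerSeries ℤ_[p]) ^ p - 1) =
      C u * G * G'.subst ((1 + X : PowerSeries ℤ_[p]) ^ p - 1)) :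
    u = 1 ∧ ∃ d : ℤ_[p], IsUnit d ∧ G' = C d * G := by
  set φ : PowerSeries ℤ_[p] := (1 + X : PowerSeries ℤ_[p]) ^ p - 1 with hφ
  have hφs : HasSubst φ := hasSubst_one_add_X_pow_sub_one p
  obtain ⟨P, U, HPU⟩ := G.exists_isWeierstrassFactorization hG
  obtain ⟨P', U', HPU'⟩ := G'.exists_isWeierstrassFactorization hG'
  -- Weierstrass factorizations of the two sides
  have H1 : PowerSeries.IsWeierstrassFactorization (G' * G.subst φ)
      (P' * P.comp ((1 + Polynomial.X : Polynomial ℤ_[p]) ^ p - 1)) (U' * U.subst φ) :=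
    HPU'.mul (isWeierstrassFactorization_subst_one_add_X_pow_prime_sub_one HPU)
  have H2 : PowerSeries.IsWeierstrassFactorization (G' * G.subst φ)
      (P * P'.comp ((1 + Polynomial.X : Polynomial ℤ_[p]) ^ p - 1)) (u • (U * U'.subst φ)) := by
    have H := (HPU.mul (isWeierstrassFactorization_subst_one_add_X_pow_prime_sub_one HPU')).smul hu
    rw [h, mul_assoc, ← smul_eq_C_mul]
    exact H
  obtain ⟨hPP, hUU⟩ := PowerSeries.IsWeierstrassFactorization.elim H1 H2
  -- the polynomial identity forces `P = P'`
  have hPeq : P = P' := by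
    obtain ⟨hdist, hdeg⟩ := isDistinguishedAt_one_add_X_pow_prime_sub_one (p := p)
    have hinj : Function.Injective (algebraMap ℤ_[p] ℚ_[p]) := IsFractionRing.injective ℤ_[p] ℚ_[p]
    apply Polynomial.map_injective (algebraMap ℤ_[p] ℚ_[p]) hinj
    have hm := congr_arg (Polynomial.map (algebraMap ℤ_[p] ℚ_[p])) hPP
    simp only [Polynomial.map_mul, Polynomial.map_comp] at hm
    refine eq_of_mul_comp_eq_mul_comp (HPU.isDistinguishedAt.monic.map _)
      (HPU'.isDistinguishedAt.monic.map _) ?_ hm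
    rw [Polynomial.natDegree_map_eq_of_injective hinj, hdeg]
    exact hp.out.two_le
  subst hPeq
  -- the unit identity: `U' · U∘φ = u · U · U'∘φ`; put `V = U' · U⁻¹`
  obtain ⟨Ui, hUi⟩ := HPU.isUnit.exists_right_inv
  set V : PowerSeries ℤ_[p] := U' * Ui with hV
  have hU'eq : U' = V * U := by rw [hV, mul_assoc, mul_comm Ui, hUi, mul_one]
  have hU0 : U ≠ 0 := HPU.isUnit.ne_zero
  have hUφ0 : U.subst φ ≠ 0 := (isUnit_subst_one_add_X_pow_sub_one p HPU.isUnit).ne_zero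
  have hVrel : V = C u * V.subst φ := by
    have h1 : U * U.subst φ * V = U * U.subst φ * (C u * V.subst φ) := by
      calc U * U.subst φ * V = U' * U.subst φ := by rw [hU'eq]; ring
        _ = u • (U * U'.subst φ) := hUU
        _ = u • (U * (V.subst φ * U.subst φ)) := by rw [hU'eq, subst_mul hφs]
        _ = U * U.subst φ * (C u * V.subst φ) := by rw [smul_eq_C_mul]; ring
    exact mul_left_cancel₀ (mul_ne_zero hU0 hUφ0) h1
  have hVunit : IsUnit V := by
    rw [hV]
    exact HPU'.isUnit.mul (IsUnit.of_mul_eq_one_right _ hUi)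
  have hV0 : constantCoeff V ≠ 0 := (isUnit_iff_constantCoeff.mp hVunit).ne_zero
  obtain ⟨hu1, hVC⟩ := eq_C_of_eq_C_mul_subst_one_add_X_pow_sub_one p hp.out.two_le hV0 hVrel
  refine ⟨hu1, constantCoeff V, isUnit_iff_constantCoeff.mp hVunit, ?_⟩
  rw [HPU'.eq_mul, HPU.eq_mul, hU'eq, hVC, constantCoeff_C]
  ring

/-- Valuation bookkeeping: if `(w · p^i) · H = (w' · p^j) · H'` in `Λ` with `w` a unit, `H` of
non-zero reduction mod `p` and `i ≤ j`, then `i = j`. [folklore] -/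
theorem eq_of_C_mul_pow_mul_eq_of_le {H H' : PowerSeries ℤ_[p]}
    (hH : PowerSeries.map (IsLocalRing.residue ℤ_[p]) H ≠ 0) {w w' : ℤ_[p]} (hw : IsUnit w)
    {i j : ℕ} (hij : i ≤ j)
    (h : C (w * (p : ℤ_[p]) ^ i) * H = C (w' * (p : ℤ_[p]) ^ j) * H') : i = j := by
  by_contra hne
  have hlt : i < j := lt_of_le_of_ne hij hne
  obtain ⟨k, rfl⟩ := Nat.exists_eq_add_of_lt hlt
  have hpi : (C ((p : ℤ_[p]) ^ i) : PowerSeries ℤ_[p]) ≠ 0 := by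
    rw [Ne, map_eq_zero_iff _ (C_injective (R := ℤ_[p]))]
    exact pow_ne_zero _ (Nat.cast_ne_zero.mpr hp.out.ne_zero)
  have h1 : C ((p : ℤ_[p]) ^ i) * (C w * H) =
      C ((p : ℤ_[p]) ^ i) * (C (w' * (p : ℤ_[p]) ^ (k + 1)) * H') := by
    calc C ((p : ℤ_[p]) ^ i) * (C w * H) = C (w * (p : ℤ_[p]) ^ i) * H := by
          rw [← mul_assoc, ← map_mul, mul_comm _ w]
      _ = C (w' * (p : ℤ_[p]) ^ (i + k + 1)) * H' := h
      _ = C ((p : ℤ_[p]) ^ i) * (C (w' * (p : ℤ_[p]) ^ (k + 1)) * H') := by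
          rw [← mul_assoc, ← map_mul]; ring_nf
  have h2 := mul_left_cancel₀ hpi h1
  have hres : IsLocalRing.residue ℤ_[p] (p : ℤ_[p]) = 0 := by
    rw [IsLocalRing.residue_eq_zero_iff, PadicInt.maximalIdeal_eq_span_p]
    exact Ideal.mem_span_singleton_self _
  have h3 := congr_arg (PowerSeries.map (IsLocalRing.residue ℤ_[p])) h2
  rw [map_mul, map_mul, map_C, map_C, map_mul, map_pow, pow_succ, hres, mul_zero, mul_zero,
    map_zero, zero_mul] at h3
  have hw0 : (C (IsLocalRing.residue ℤ_[p] w) : PowerSeries (IsLocalRing.ResidueField ℤ_[p])) ≠ 0 := by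
    rw [Ne, map_eq_zero_iff _ (C_injective (R := IsLocalRing.ResidueField ℤ_[p])),
      IsLocalRing.residue_eq_zero_iff, IsLocalRing.mem_maximalIdeal, mem_nonunits_iff, not_not]
    exact hw
  exact (mul_ne_zero hw0 hH) h3

/-- Valuation bookkeeping, symmetric form: `(w · p^i) · H = (w' · p^j) · H'` with `w, w'` units
and `H, H'` of non-zero reduction forces `i = j`. [folklore] -/
theorem eq_of_C_mul_pow_mul_eq {H H' : PowerSeries ℤ_[p]}
    (hH : PowerSeries.map (IsLocalRing.residue ℤ_[p]) H ≠ 0)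
    (hH' : PowerSeries.map (IsLocalRing.residue ℤ_[p]) H' ≠ 0) {w w' : ℤ_[p]} (hw : IsUnit w)
    (hw' : IsUnit w') {i j : ℕ}
    (h : C (w * (p : ℤ_[p]) ^ i) * H = C (w' * (p : ℤ_[p]) ^ j) * H') : i = j := by
  rcases le_total i j with hij | hji
  · exact eq_of_C_mul_pow_mul_eq_of_le hH hw hij h
  · exact (eq_of_C_mul_pow_mul_eq_of_le hH' hw' hji h.symm).symm

end IntegralRigidity

/-! ### §2 The rational form: rigidity in `Λ ⊗ ℚ_p` -/

section RationalRigidity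

open _root_.PowerSeries

variable {p : ℕ} [hp : Fact p.Prime]

/-- `ι : Λ → ℚ_p⟦T⟧` maps `(1+T)^p - 1` to `(1+T)^p - 1`. [folklore] -/
theorem iwasawaToPowerSeries_one_add_X_pow_sub_one (N : ℕ) :
    iwasawaToPowerSeries p ((1 + X : PowerSeries ℤ_[p]) ^ N - 1) =
      (1 + X : PowerSeries ℚ_[p]) ^ N - 1 := by
  rw [map_sub, map_pow, map_add, map_one, iwasawaToPowerSeries, map_X]

/-- `ι` commutes with the power map: `ι(G((1+T)^N - 1)) = (ιG)((1+T)^N - 1)`. [folklore] -/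
theorem iwasawaToPowerSeries_subst_one_add_X_pow_sub_one (N : ℕ) (G : PowerSeries ℤ_[p]) :
    iwasawaToPowerSeries p (G.subst ((1 + X : PowerSeries ℤ_[p]) ^ N - 1)) =
      (iwasawaToPowerSeries p G).subst ((1 + X : PowerSeries ℚ_[p]) ^ N - 1) := by
  rw [← iwasawaToPowerSeries_one_add_X_pow_sub_one]
  exact PowerSeries.map_subst (hasSubst_one_add_X_pow_sub_one N) G

/-- Scalars pass through the power map: `(c · B)((1+T)^N - 1) = c · B((1+T)^N - 1)`. [folklore] -/
theorem subst_C_mul_one_add_X_pow_sub_one {R : Type*} [CommRing R] (N : ℕ) (c : R)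
    (B : PowerSeries R) :
    (C c * B).subst ((1 + X : PowerSeries R) ^ N - 1) =
      C c * B.subst ((1 + X : PowerSeries R) ^ N - 1) := by
  rw [subst_mul (hasSubst_one_add_X_pow_sub_one N), subst_C]
  rfl

/-- `Λ ⊗ ℚ_p` is closed under products. [folklore] -/
theorem memIwasawaRat_mul {B B' : PowerSeries ℚ_[p]} (hB : MemIwasawaRat p B)
    (hB' : MemIwasawaRat p B') : MemIwasawaRat p (B * B') := by
  obtain ⟨n, G, hG⟩ := hB
  obtain ⟨n', G', hG'⟩ := hB'
  refine ⟨n + n', G * G', ?_⟩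
  rw [map_mul, ← hG, ← hG', pow_add, map_mul]
  ring

/-- `Λ ⊗ ℚ_p` is stable under the power map `B ↦ B((1+T)^N - 1)`. [folklore] -/
theorem memIwasawaRat_subst_one_add_X_pow_sub_one {B : PowerSeries ℚ_[p]} (hB : MemIwasawaRat p B)
    (N : ℕ) : MemIwasawaRat p (B.subst ((1 + X : PowerSeries ℚ_[p]) ^ N - 1)) := by
  obtain ⟨n, G, hG⟩ := hB
  refine ⟨n, G.subst ((1 + X : PowerSeries ℤ_[p]) ^ N - 1), ?_⟩
  rw [iwasawaToPowerSeries_subst_one_add_X_pow_sub_one, ← hG, subst_C_mul_one_add_X_pow_sub_one]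

/-- Any two `p`-adic numbers become `p`-adic integers after multiplication by a common power of `p`.
[folklore] -/
theorem exists_norm_pow_mul_le_one (x y : ℚ_[p]) :
    ∃ N : ℕ, ‖(p : ℚ_[p]) ^ N * x‖ ≤ 1 ∧ ‖(p : ℚ_[p]) ^ N * y‖ ≤ 1 := by
  have hp1 : (1 : ℝ) < p := by exact_mod_cast hp.out.one_lt
  obtain ⟨N, hN⟩ := pow_unbounded_of_one_lt (max ‖x‖ ‖y‖) hp1
  have hpos : (0 : ℝ) < (p : ℝ) ^ N := by positivity
  have key : ∀ z : ℚ_[p], ‖z‖ ≤ max ‖x‖ ‖y‖ → ‖(p : ℚ_[p]) ^ N * z‖ ≤ 1 := fun z hz ↦ by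
    rw [norm_mul, norm_pow, Padic.norm_p, inv_pow]
    calc ((p : ℝ) ^ N)⁻¹ * ‖z‖ ≤ ((p : ℝ) ^ N)⁻¹ * (p : ℝ) ^ N :=
          mul_le_mul_of_nonneg_left (hz.trans hN.le) (inv_nonneg.mpr hpos.le)
      _ = 1 := inv_mul_cancel₀ hpos.ne'
  exact ⟨N, key x (le_max_left _ _), key y (le_max_right _ _)⟩

/-- `Λ ⊗ ℚ_p` is stable under `ℚ_p`-scalars. [folklore] -/
theorem memIwasawaRat_C_mul {B : PowerSeries ℚ_[p]} (hB : MemIwasawaRat p B) (c : ℚ_[p]) :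
    MemIwasawaRat p (C c * B) := by
  obtain ⟨n, G, hG⟩ := hB
  obtain ⟨N, hN, -⟩ := exists_norm_pow_mul_le_one c 0
  let c₀ : ℤ_[p] := ⟨(p : ℚ_[p]) ^ N * c, hN⟩
  have hc₀ : (c₀ : ℚ_[p]) = (p : ℚ_[p]) ^ N * c := rfl
  refine ⟨N + n, C c₀ * G, ?_⟩
  rw [map_mul, ← hG, iwasawaToPowerSeries, map_C, pow_add, map_mul]
  change _ = C (c₀ : ℚ_[p]) * _
  rw [hc₀, map_mul]
  ring

/-- **Rigidity of the `p`-power functional equation in `Λ ⊗ ℚ_p`.** Let `B, B' ∈ ℚ_p⟦T⟧` be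
non-zero with bounded coefficients (`MemIwasawaRat`), `α ≠ 0`, `α' ∈ ℚ_p`, and suppose
`α · B · B'((1+T)^p - 1) = α' · B' · B((1+T)^p - 1)`. Then `α = α'` and `B' = d · B` for a
constant `d ∈ ℚ_p`. (Clear denominators and `p`-contents and apply the integral rigidity
`eq_one_and_exists_eq_C_mul_of_mul_subst_eq`; the `p`-adic valuations of `α`, `α'` agree by
reduction mod `p`, `eq_of_C_mul_pow_mul_eq`.) This is the algebraic heart of the TUPLE RIGIDITY of
interpolation packages of cyclotomic `p`-adic `L`-functions (`TameBranchRigidity.lean`).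
[folklore] -/
theorem eq_and_exists_eq_C_mul_of_mul_subst_eq {B B' : PowerSeries ℚ_[p]}
    (hB : MemIwasawaRat p B) (hB' : MemIwasawaRat p B') (hB0 : B ≠ 0) (hB'0 : B' ≠ 0)
    {α α' : ℚ_[p]} (hα : α ≠ 0)
    (h : C α * B * B'.subst ((1 + X : PowerSeries ℚ_[p]) ^ p - 1) =
      C α' * B' * B.subst ((1 + X : PowerSeries ℚ_[p]) ^ p - 1)) :
    α = α' ∧ ∃ d : ℚ_[p], B' = C d * B := by
  have hp0 : (p : ℚ_[p]) ≠ 0 := Nat.cast_ne_zero.mpr hp.out.ne_zero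
  have hCp : ∀ k : ℕ, (C ((p : ℚ_[p]) ^ k) : PowerSeries ℚ_[p]) ≠ 0 := fun k ↦ by
    rw [Ne, map_eq_zero_iff _ (C_injective (R := ℚ_[p]))]
    exact pow_ne_zero _ hp0
  set φ : PowerSeries ℚ_[p] := (1 + X : PowerSeries ℚ_[p]) ^ p - 1 with hφ
  set ψ : PowerSeries ℤ_[p] := (1 + X : PowerSeries ℤ_[p]) ^ p - 1 with hψ
  -- `α' ≠ 0`
  have hα' : α' ≠ 0 := by
    intro h0
    rw [h0, map_zero, zero_mul, zero_mul] at h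
    rcases mul_eq_zero.mp h with h1 | h1
    · rcases mul_eq_zero.mp h1 with h2 | h2
      · exact hα ((map_eq_zero_iff _ (C_injective (R := ℚ_[p]))).mp h2)
      · exact hB0 h2
    · exact hB'0 (eq_zero_of_subst_one_add_X_pow_sub_one_eq_zero p hp.out.ne_zero h1)
  -- integral models
  obtain ⟨n, G, hG⟩ := hB
  obtain ⟨n', G', hG'⟩ := hB'
  have hG0 : G ≠ 0 := by
    rintro rfl
    rw [map_zero] at hG
    exact hB0 ((mul_eq_zero.mp hG).resolve_left (hCp n))
  have hG'0 : G' ≠ 0 := by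
    rintro rfl
    rw [map_zero] at hG'
    exact hB'0 ((mul_eq_zero.mp hG').resolve_left (hCp n'))
  obtain ⟨m, G₁, hGG₁, hG₁⟩ := IwasawaAlgebra.exists_eq_C_pow_mul_and_map_residue_ne_zero p hG0
  obtain ⟨m', G₁', hGG₁', hG₁'⟩ := IwasawaAlgebra.exists_eq_C_pow_mul_and_map_residue_ne_zero p hG'0
  -- `p^m · ιG₁ = p^n · B`, and the same after the power map
  have hιC : ∀ k : ℕ, iwasawaToPowerSeries p (C ((p : ℤ_[p]) ^ k)) = C ((p : ℚ_[p]) ^ k) :=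
    fun k ↦ by rw [iwasawaToPowerSeries, map_C, map_pow, map_natCast]
  have e1 : C ((p : ℚ_[p]) ^ m) * iwasawaToPowerSeries p G₁ = C ((p : ℚ_[p]) ^ n) * B := by
    rw [hG, hGG₁, map_mul, hιC]
  have e2 : C ((p : ℚ_[p]) ^ m') * iwasawaToPowerSeries p G₁' = C ((p : ℚ_[p]) ^ n') * B' := by
    rw [hG', hGG₁', map_mul, hιC]
  have e3 : C ((p : ℚ_[p]) ^ m) * iwasawaToPowerSeries p (G₁.subst ψ) =
      C ((p : ℚ_[p]) ^ n) * B.subst φ := by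
    rw [iwasawaToPowerSeries_subst_one_add_X_pow_sub_one, ← subst_C_mul_one_add_X_pow_sub_one,
      e1, subst_C_mul_one_add_X_pow_sub_one]
  have e4 : C ((p : ℚ_[p]) ^ m') * iwasawaToPowerSeries p (G₁'.subst ψ) =
      C ((p : ℚ_[p]) ^ n') * B'.subst φ := by
    rw [iwasawaToPowerSeries_subst_one_add_X_pow_sub_one, ← subst_C_mul_one_add_X_pow_sub_one,
      e2, subst_C_mul_one_add_X_pow_sub_one]
  -- clear the denominators of `α`, `α'`
  obtain ⟨N, hNα, hNα'⟩ := exists_norm_pow_mul_le_one α α'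
  let a : ℤ_[p] := ⟨(p : ℚ_[p]) ^ N * α, hNα⟩
  let a' : ℤ_[p] := ⟨(p : ℚ_[p]) ^ N * α', hNα'⟩
  have ha : (a : ℚ_[p]) = (p : ℚ_[p]) ^ N * α := rfl
  have ha' : (a' : ℚ_[p]) = (p : ℚ_[p]) ^ N * α' := rfl
  have ha0 : a ≠ 0 := by
    intro h0
    have h1 : (a : ℚ_[p]) = 0 := by rw [h0, PadicInt.coe_zero]
    rw [ha, mul_eq_zero] at h1
    exact h1.elim (pow_ne_zero _ hp0) hα
  have ha'0 : a' ≠ 0 := by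
    intro h0
    have h1 : (a' : ℚ_[p]) = 0 := by rw [h0, PadicInt.coe_zero]
    rw [ha', mul_eq_zero] at h1
    exact h1.elim (pow_ne_zero _ hp0) hα'
  -- the relation in `Λ`
  have hrel : C a * (G₁ * G₁'.subst ψ) = C a' * (G₁' * G₁.subst ψ) := by
    apply iwasawaToPowerSeries_injective p
    apply mul_left_cancel₀ (hCp (m + m'))
    have hιa : iwasawaToPowerSeries p (C a) = C ((p : ℚ_[p]) ^ N) * C α := by
      rw [iwasawaToPowerSeries, map_C, ← map_mul, ← ha]; rfl
    have hιa' : iwasawaToPowerSeries p (C a') = C ((p : ℚ_[p]) ^ N) * C α' := by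
      rw [iwasawaToPowerSeries, map_C, ← map_mul, ← ha']; rfl
    rw [map_mul, map_mul, map_mul, map_mul, hιa, hιa', pow_add, map_mul]
    linear_combination
      C ((p : ℚ_[p]) ^ N) * C α * C ((p : ℚ_[p]) ^ m') * iwasawaToPowerSeries p (G₁'.subst ψ) * e1 +
      C ((p : ℚ_[p]) ^ N) * C α * C ((p : ℚ_[p]) ^ n) * B * e4 +
      C ((p : ℚ_[p]) ^ N) * C ((p : ℚ_[p]) ^ n) * C ((p : ℚ_[p]) ^ n') * h -
      C ((p : ℚ_[p]) ^ N) * C α' * C ((p : ℚ_[p]) ^ m) * iwasawaToPowerSeries p (G₁.subst ψ) * e2 -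
      C ((p : ℚ_[p]) ^ N) * C α' * C ((p : ℚ_[p]) ^ n') * B' * e3
  -- valuations of `a`, `a'` agree
  have hH : PowerSeries.map (IsLocalRing.residue ℤ_[p]) (G₁ * G₁'.subst ψ) ≠ 0 := by
    rw [map_mul]
    exact mul_ne_zero hG₁ (map_residue_subst_ne_zero hG₁')
  have hH' : PowerSeries.map (IsLocalRing.residue ℤ_[p]) (G₁' * G₁.subst ψ) ≠ 0 := by
    rw [map_mul]
    exact mul_ne_zero hG₁' (map_residue_subst_ne_zero hG₁)
  have hsa := PadicInt.unitCoeff_spec ha0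
  have hsa' := PadicInt.unitCoeff_spec ha'0
  set w : ℤ_[p] := (PadicInt.unitCoeff ha0 : ℤ_[p]) with hw_def
  set w' : ℤ_[p] := (PadicInt.unitCoeff ha'0 : ℤ_[p]) with hw'_def
  have hw : IsUnit w := Units.isUnit _
  have hw' : IsUnit w' := Units.isUnit _
  rw [hsa, hsa'] at hrel
  have hv : a.valuation = a'.valuation := eq_of_C_mul_pow_mul_eq hH hH' hw hw' hrel
  -- cancel `p^v` and apply the integral rigidity
  rw [← hv, map_mul, map_mul, mul_comm (C w), mul_comm (C w'), mul_assoc, mul_assoc] at hrel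
  have hrel2 := mul_left_cancel₀ (by
    rw [Ne, map_eq_zero_iff _ (C_injective (R := ℤ_[p]))]
    exact pow_ne_zero _ (Nat.cast_ne_zero.mpr hp.out.ne_zero)) hrel
  obtain ⟨wi, hwi⟩ := hw'.exists_left_inv
  have hrel3 : G₁' * G₁.subst ψ = C (wi * w) * G₁ * G₁'.subst ψ := by
    calc G₁' * G₁.subst ψ = C (wi * w') * (G₁' * G₁.subst ψ) := by rw [hwi, map_one, one_mul]
      _ = C wi * (C w' * (G₁' * G₁.subst ψ)) := by rw [map_mul, mul_assoc]
      _ = C wi * (C w * (G₁ * G₁'.subst ψ)) := by rw [hrel2]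
      _ = C (wi * w) * G₁ * G₁'.subst ψ := by rw [map_mul]; ring
  obtain ⟨hu1, d, -, hd⟩ := eq_one_and_exists_eq_C_mul_of_mul_subst_eq hG₁ hG₁'
    ((IsUnit.of_mul_eq_one _ hwi).mul hw) hrel3
  -- `w = w'`, so `a = a'` and `α = α'`
  have hww : w = w' := by
    calc w = w' * (wi * w) := by rw [← mul_assoc, mul_comm w' wi, hwi, one_mul]
      _ = w' := by rw [hu1, mul_one]
  have haa : a = a' := by rw [hsa, hsa', hww, hv]
  have hαα : α = α' := by
    have h1 : (a : ℚ_[p]) = (a' : ℚ_[p]) := by rw [haa]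
    rw [ha, ha'] at h1
    exact mul_left_cancel₀ (pow_ne_zero N hp0) h1
  refine ⟨hαα, ((p : ℚ_[p]) ^ n')⁻¹ * (p : ℚ_[p]) ^ m' * algebraMap ℤ_[p] ℚ_[p] d *
    ((p : ℚ_[p]) ^ m)⁻¹ * (p : ℚ_[p]) ^ n, ?_⟩
  -- `B' = d' · B`
  have hιd : iwasawaToPowerSeries p (C d) = C (algebraMap ℤ_[p] ℚ_[p] d) := by
    rw [iwasawaToPowerSeries, map_C]
  have hinv : ∀ k : ℕ, (C (((p : ℚ_[p]) ^ k)⁻¹) : PowerSeries ℚ_[p]) * C ((p : ℚ_[p]) ^ k) = 1 :=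
    fun k ↦ by rw [← map_mul, inv_mul_cancel₀ (pow_ne_zero _ hp0), map_one]
  calc B' = C (((p : ℚ_[p]) ^ n')⁻¹) * (C ((p : ℚ_[p]) ^ n') * B') := by
        rw [← mul_assoc, hinv, one_mul]
    _ = C (((p : ℚ_[p]) ^ n')⁻¹) * (C ((p : ℚ_[p]) ^ m') * iwasawaToPowerSeries p G₁') := by
        rw [e2]
    _ = C (((p : ℚ_[p]) ^ n')⁻¹) * (C ((p : ℚ_[p]) ^ m') * (C (algebraMap ℤ_[p] ℚ_[p] d) *
          (C (((p : ℚ_[p]) ^ m)⁻¹) * (C ((p : ℚ_[p]) ^ m) * iwasawaToPowerSeries p G₁)))) := by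
        rw [← mul_assoc (C (((p : ℚ_[p]) ^ m)⁻¹)), hinv, one_mul, hd, map_mul, hιd]
    _ = C (((p : ℚ_[p]) ^ n')⁻¹) * (C ((p : ℚ_[p]) ^ m') * (C (algebraMap ℤ_[p] ℚ_[p] d) *
          (C (((p : ℚ_[p]) ^ m)⁻¹) * (C ((p : ℚ_[p]) ^ n) * B)))) := by rw [e1]
    _ = C (((p : ℚ_[p]) ^ n')⁻¹ * (p : ℚ_[p]) ^ m' * algebraMap ℤ_[p] ℚ_[p] d *
          ((p : ℚ_[p]) ^ m)⁻¹ * (p : ℚ_[p]) ^ n) * B := by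
        simp only [map_mul]
        ring

end RationalRigidity

end Summit.BirchSwinnertonDyer.Rank1Residual.Additive

end
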